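import Literature.Probability.Percolation.CircuitTriples
import Summits.CriticalPhenomena.PercolationContinuityZ3.Theorems.PercNearOneGluingNoHeavyLowerTailSahiCombJuntaIntersectionAllOrders
import Summits.CriticalPhenomena.PercolationContinuityZ3.Theorems.PercNearOneGluingNoHeavyLowerTailSahiConjectureCubeFour
import Summits.CriticalPhenomena.PercolationContinuityZ3.Theorems.PercNearOneGluingNoHeavyLowerTailCertRowsDual

/-!
# DECREASING events: the all-orders free-slot / junta-intersection classes by reflection `ω ↦ ωᶜ`, `q ↦ 1 − q`

Support file (cell `prim-sahi`, seat `prim-sahi-typer` gen 36; `--supports stmt-CriticalPhenomena-4575`; proposed `--computational` — the five-letter instances inherit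
the declared `native_decide` axioms of `SahiCombFive.combPos_sahiE_of_card_le_five_all`; the reflection identity is pure).  No definitions, no named facts, no `sorry`.

Percolation's separation / disconnection events are DECREASING.  The all-orders classes of `…SahiCombJuntaAllOrders` / `…SahiCombJuntaIntersectionAllOrders` (this
generation) are stated for increasing events; complementation carries them over, every order:
* `sahiE_ind_eq_sahiE_ind_preimage_compl` — `E_n(μ_q; 1_{D_0},…,1_{D_{n−1}}) = E_n(μ_{1−q}; 1_{compl⁻¹ D_0},…)` (push-forward along `ω ↦ ωᶜ`,
  `NCopyCert.bernoulliWeightDual_eq_pushWeight_compl` + `sahiE_pushWeight`); `W`-determinedness and intersections are preserved by `compl⁻¹`.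
* **`sahiE_ind_nonneg_of_pairwise_inter_determinedBy_lower_card_le_five`** — for every `n`, every product measure, every dimension: DECREASING events `D_0,…,D_{n−1}`
  with at most one free slot `k` and all other pairwise intersections `D_a ∩ D_b` determined by at most five common coordinates have `E_n(μ_q; 1_D) ≥ 0`;
* `sahiE_ind_nonneg_of_allButOne_determinedBy_lower_card_le_five` — one arbitrary decreasing event + decreasing `≤ 5`-juntas on a common `W`.
HONEST LABEL: classes only; Sahi's `C_n` remains OPEN in general. [this work]
-/

noncomputable section

open scoped Classical

namespace Summit.CriticalPhenomena.PercolationContinuityZ3.Theorems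

namespace SahiCombJunta

open Finset Function
open Literature.Combinatorics.Sahi2008
open Literature.Probability.Percolation (DeterminedBy determinedBy_iff)
open Literature.Probability.Percolation.DecisionTree (ind ind_nonneg)
open SahiComb

variable {ι : Type} [Fintype ι]

/-- **Reflection at every order**: `E_n(μ_q; 1_D) = E_n(μ_{1−q}; 1_{compl⁻¹ D})`. [this work] -/
theorem sahiE_ind_eq_sahiE_ind_preimage_compl (q : ι → unitInterval) {n : ℕ} (D : Fin n → Set (Set ι)) :
    sahiE (bernoulliWeight q) n (fun i => ind (D i)) =
      sahiE (bernoulliWeight fun i => unitInterval.symm (q i)) n (fun i => ind (compl ⁻¹' (D i))) := by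
  have h1 : sahiE (bernoulliWeight q) n (fun i => ind (D i)) =
      sahiE (bernoulliWeightDual q) n (fun i (a : (Set ι)ᵒᵈ) => ind (D i) (OrderDual.ofDual a)) := rfl
  rw [h1, NCopyCert.bernoulliWeightDual_eq_pushWeight_compl, sahiE_pushWeight]
  rfl

/-- **Decreasing events, the junta-intersection class, every order** (five coordinates): `D_i` lower sets, slot `k` free, all other pairwise
intersections determined by `W`, `|W| ≤ 5` ⟹ `0 ≤ E_n(μ_q; 1_{D_0},…,1_{D_{n−1}})`. [this work] [computational] -/
theorem sahiE_ind_nonneg_of_pairwise_inter_determinedBy_lower_card_le_five (q : ι → unitInterval) (W : Finset ι) (hW : W.card ≤ 5)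
    {n : ℕ} (k : Fin n) {D : Fin n → Set (Set ι)} (hD : ∀ i, IsLowerSet (D i))
    (hpair : ∀ a b, a ≠ b → a ≠ k → b ≠ k → DeterminedBy (D a ∩ D b) (↑W : Set ι)) :
    0 ≤ sahiE (bernoulliWeight q) n (fun i => ind (D i)) := by
  rw [sahiE_ind_eq_sahiE_ind_preimage_compl]
  refine sahiE_ind_nonneg_of_pairwise_inter_determinedBy_card_le_five _ W hW k (fun i => CertCells.isUpperSet_preimage_compl (hD i))
    fun a b hab ha hb => ?_
  rw [← Set.preimage_inter]
  exact (hpair a b hab ha hb).preimage_compl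

/-- **Decreasing events, one free slot + juntas, every order** (five coordinates). [this work] [computational] -/
theorem sahiE_ind_nonneg_of_allButOne_determinedBy_lower_card_le_five (q : ι → unitInterval) (W : Finset ι) (hW : W.card ≤ 5)
    {n : ℕ} (k : Fin n) {D : Fin n → Set (Set ι)} (hD : ∀ i, IsLowerSet (D i)) (hDd : ∀ i, i ≠ k → DeterminedBy (D i) (↑W : Set ι)) :
    0 ≤ sahiE (bernoulliWeight q) n (fun i => ind (D i)) := by
  rw [sahiE_ind_eq_sahiE_ind_preimage_compl]
  exact sahiE_ind_nonneg_of_allButOne_determinedBy_card_le_five _ W hW k (fun i => CertCells.isUpperSet_preimage_compl (hD i))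
    fun i hi => (hDd i hi).preimage_compl

end SahiCombJunta

end Summit.CriticalPhenomena.PercolationContinuityZ3.Theorems
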